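import Literature.MathematicalPhysics.QuantumFieldTheory.Balaban1983to89.B12RegularSpaces111Gauge
import Literature.MathematicalPhysics.QuantumFieldTheory.Balaban1983to89.B12Membership313II

/-!
# `Balaban1983to89.B12Spaces329NearBond` — T. Bałaban, *Renormalization group approach to lattice gauge field theories. I*,
Commun. Math. Phys. **109** (1987) 249–301 [Balaban1987RG1]: the bond-level algebra behind the clause of (3.29) p. 276 «for
Gᶜ-valued transformations u in a sufficiently small neighborhood of G-valued transformations, so that the configurations after the
transformations belong to proper spaces also» — a `Gᶜ`-valued gauge transformation `v = w·exp(iξE)` near a `G`-valued `w` acting on a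
factorised configuration `𝐔 = (exp iξA′)U` FACTORISES AGAIN, `𝐔^v = (exp iξA‴)U^w`, with the new potential `A‴` given by two
Baker–Campbell–Hausdorff compositions of the tree's `B12Membership313II.newPot`, and the sizes of `A‴`, of its covariant derivative, of the
conjugated plaquette variables and currents are controlled explicitly (PROVED; sibling `B12Spaces329Near` assembles conditions (i)–(iii))

HONEST FRAMING (cell `lit-balaban`, verbatim): statement-level skeleton of published theorems with citation tags; proofs where landed; nothing here is a claim about the Yang–Mills mass gap.

PDF held: `paper:balaban1987-cmp109-rg-i-small-field` (journal page = PDF page + 248); read from the text layer of PDF pp. 27–28 (pp. 275–276)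
and pp. 14–15 (pp. 262–263) (`lit read … --pages`).

WHAT IS REPRODUCED.  Nothing of the paper is asserted here: this is the algebra/analysis toolkit (all statements [folklore]-level, over an
arbitrary complete normed `ℂ`-algebra `𝔸`) for the sibling `B12Spaces329Near`, which proves the «proper spaces» clause of (3.29) for the CONCRETE
conditions (i)–(iii) of `B12RegularSpaces111` (rows `B12.Eq3.28-3.29`, `B12.Eq1.11-1.14`; the same clause is the last sentence of
[Balaban1988RG2Cluster] Lemma 2, row `B13.Lem2`).  The `[cite:]` tags below mark the TEXT LOCATION ((1.10)–(1.13) p. 262, (3.29) p. 276) whose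
objects the lemmas are about; every proof is ours, from Mathlib and the landed modules `B12RegularSpaces111(Gauge)`, `B12Membership313II`
(`newPot`, `exp_smul_newPot`, `norm_newPot_le`, `norm_covD_newPot_le`, `norm_sub_le_of_expUnit_conj`, `norm_expMul_sub_one_lt_one`),
`B12Membership314` (`exp_units_conj'`, `norm_I_mul_smul`, `norm_mul_exp_le`), `Beta.TransportVertices.norm_exp_mul_le`, BY NAME.

THE PRINT, verbatim (p. 276): *«The functions (3.25), (3.26) are gauge invariant with respect to the simultaneous gauge transformations
𝐔 → 𝐔^u, 𝐉 → R(u)𝐉, B → R(u)B, (3.29)  for Gᶜ-valued transformations u in a sufficiently small neighborhood of G-valued transformations, so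
that the configurations after the transformations belong to proper spaces also.»*  p. 275: *«This space is defined by the same conditions
(i)–(iv), only the configurations 𝐔, 𝐉 are defined and satisfy (i)–(iii) on the whole lattice T_η.»*  p. 262 (the conditions): *«(i) 𝐔 = U′U,
U has values in the group G, |∂U − 1| < α₀ξ² on X, (1.11) … (ii) U′ = exp iξA′, A′ has values in the algebra 𝔤ᶜ, |A′|, |∇^ξ_U A′| < α₁ on X.
(1.13) (iii) The configurations 𝐔, 𝐉 satisfy the bounds |∂𝐔 − 1| < α₀ξ², |𝐉| < γ₀ on X. (1.14)»*.

THE MECHANISM (ours; the print gives none).  Write the transformation as `v = w·e`, `w` `G`-valued, `e(x) = exp iξE(x)` with `E` small.  At a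
bond `b = ⟨b₋, b₊⟩`:  `𝐔^v(b) = w₋e₋·e^{iξA′(b)}U(b)·e₊⁻¹w₊⁻¹ = w₋·[e^{iξE(b₋)} e^{iξA′(b)} e^{−iξR(U(b))E(b₊)}]·w₋⁻¹ · (w₋U(b)w₊⁻¹)`
(`gaugeU_factor_near`), and the bracket is `exp iξA″(b)` with `A″(b) = newPot ξ E(b₋) (newPot ξ A′(b) (−R(U(b))E(b₊)))` as soon as
`ξ(|A′| + |E|)` is small (`B12Membership313II.exp_smul_newPot`, twice; sizes `norm_newPot2_le`, `norm_newPot3_le`); conjugating by `w₋ ∈ G` gives the `G`-valued factor `U^w` and the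
potential `A‴ = R(w)A″`.  Sizes: `|A″(b)| ≤ |A′(b)| + 2δ + 8ξ(α₁ + 2δ)²` for `|E| ≤ δ`, `|A′| ≤ α₁`, `ξ(α₁ + 2δ) ≤ 1/16` (`norm_newPot3_le`);
`|e·X·e⁻¹ − 1| ≤ e^{2ξ|E|}|X − 1|`, `|e·J·e⁻¹| ≤ e^{2ξ|E|}|J|` (`norm_conj_expI_sub_one_le`, `norm_conj_expI_le`); the covariant derivative of
the transported field `b ↦ −R(U(b))E(b₊)` along a second direction differs from that of `E` by a conjugated PLAQUETTE of `U`
(`norm_covD_transport_le`: `≤ 2ξ⁻¹|W − 1||E| + |∇_U E|`, `W` the loop `U_ν(x)⁻¹U_μ(x)U_ν(x+μ)U_μ(x+ν)⁻¹`, `|W − 1| = |∂U(p) − 1|` by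
`norm_loop_sub_one_eq`/`norm_loop_sub_one_le_of_gt`); `∇^ξ_U` versus `∇^ξ_𝐔` (`norm_nabla_factor_le`).  No `Prop` placeholder, no definition,
no new fact; axioms standard.  Unit `lit-balaban-p07` (Phase-2 seat p07 gen 4; TAKING line HOME/STATUS.md 2026-08-21T04:15:06Z), HOME
`run/shared/lean/pub/lit-balaban/`.
-/

namespace Literature.MathematicalPhysics.QuantumFieldTheory.Balaban1983to89.B12Spaces329NearBond

open NormedSpace
open Literature.MathematicalPhysics.QuantumFieldTheory.Balaban1983to89
open Literature.MathematicalPhysics.QuantumFieldTheory.Balaban1983to89.B12RegularSpaces111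
open Literature.MathematicalPhysics.QuantumFieldTheory.Balaban1983to89.B12RegularSpaces111Gauge
open Literature.MathematicalPhysics.QuantumFieldTheory.Balaban1983to89.B12Membership314
open Literature.MathematicalPhysics.QuantumFieldTheory.Balaban1983to89.B12Membership313II
open Complex (I)

noncomputable section

variable {𝔸 : Type*} [NormedRing 𝔸] [NormedAlgebra ℂ 𝔸] [CompleteSpace 𝔸]

/-! ## §1. Units of the form `exp iξa`: inverse, products (BCH), conjugation -/

/-- `(exp iξa)⁻¹ = exp iξ(−a)` as units. [cite: Balaban1987RG1, (1.13) p.262] -/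
theorem inv_expI (ξ : ℝ) (a : 𝔸) : (expI ξ a)⁻¹ = expI ξ (-a) := by
  ext
  simp only [expI, Beta.BackgroundVertices.val_inv_expUnit, Beta.BackgroundVertices.val_expUnit, smul_neg]

/-- Smallness for one BCH step: `ξ(|a| + |b|) ≤ 1/4 ⟹ |e^{iξa}e^{iξb} − 1| < 1` (`ξ ≥ 0`). [folklore] -/
private theorem norm_expProd_sub_one_lt_one {ξ : ℝ} (hξ : 0 ≤ ξ) {a b : 𝔸} (h : ξ * (‖a‖ + ‖b‖) ≤ 1 / 4) :
    ‖exp ((I * ξ) • a) * exp ((I * ξ) • b) - 1‖ < 1 :=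
  norm_expMul_sub_one_lt_one (by rw [norm_I_mul_smul hξ, norm_I_mul_smul hξ]; linarith)

/-- **One BCH step as an identity of units**: `exp iξa · exp iξb = exp iξ(newPot ξ a b)` for `ξ(|a| + |b|) ≤ 1/4`, `ξ > 0`
(`B12Membership313II.exp_smul_newPot`). [cite: Balaban1987RG1, (1.13) p.262] -/
theorem expI_mul_expI {ξ : ℝ} (hξ : 0 < ξ) {a b : 𝔸} (h : ξ * (‖a‖ + ‖b‖) ≤ 1 / 4) :
    expI ξ a * expI ξ b = expI ξ (newPot ξ a b) := by
  ext
  simp only [Units.val_mul, expI, Beta.BackgroundVertices.val_expUnit]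
  exact (exp_smul_newPot hξ.ne' (norm_expProd_sub_one_lt_one hξ.le h)).symm

/-- `U · exp iξa = exp iξ(UaU⁻¹) · U` («R(U)X = UXU⁻¹» commutes with the exponential; `B12RegularSpaces111Gauge.conj_expI`).
[cite: Balaban1987RG1, (1.10) p.262] -/
theorem mul_expI_eq (U : 𝔸ˣ) (ξ : ℝ) (a : 𝔸) : U * expI ξ a = expI ξ ((U : 𝔸) * a * ↑U⁻¹) * U := by
  rw [← conj_expI, inv_mul_cancel_right]

/-! ## §2. Conjugation by `exp iξE`: plaquette variables and currents move by the factor `e^{2ξ|E|}` -/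

omit [CompleteSpace 𝔸] in
/-- `|iξ•E| = ξ|E|`, `|−(iξ•E)| = ξ|E|` (`ξ ≥ 0`). [folklore] -/
private theorem norm_neg_I_smul {ξ : ℝ} (hξ : 0 ≤ ξ) (E : 𝔸) : ‖-((I * ξ) • E)‖ = ξ * ‖E‖ := by
  rw [norm_neg, norm_I_mul_smul hξ]

/-- **`|e·X·e⁻¹| ≤ e^{2ξ|E|}·|X|`** for `e = exp iξE` (`ξ ≥ 0`; no `‖1‖ = 1`: `Beta.TransportVertices.norm_exp_mul_le`,
`B12Membership314.norm_mul_exp_le`) — the currents `𝐉 → R(e)𝐉` of (3.29). [cite: Balaban1987RG1, (3.29) p.276] -/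
theorem norm_conj_expI_le {ξ : ℝ} (hξ : 0 ≤ ξ) (E X : 𝔸) :
    ‖(expI ξ E : 𝔸) * X * ↑(expI ξ E)⁻¹‖ ≤ Real.exp (2 * (ξ * ‖E‖)) * ‖X‖ := by
  simp only [expI, Beta.BackgroundVertices.val_inv_expUnit, Beta.BackgroundVertices.val_expUnit]
  rw [mul_assoc]
  calc ‖exp ((I * ξ) • E) * (X * exp (-((I * ξ) • E)))‖
      ≤ Real.exp ‖(I * ξ) • E‖ * ‖X * exp (-((I * ξ) • E))‖ := Beta.TransportVertices.norm_exp_mul_le ℂ _ _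
    _ ≤ Real.exp ‖(I * ξ) • E‖ * (‖X‖ * Real.exp ‖-((I * ξ) • E)‖) :=
        mul_le_mul_of_nonneg_left (norm_mul_exp_le _ _) (Real.exp_pos _).le
    _ = Real.exp (2 * (ξ * ‖E‖)) * ‖X‖ := by
        rw [norm_neg_I_smul hξ, norm_I_mul_smul hξ, two_mul, Real.exp_add]; ring

/-- **`|e·X·e⁻¹ − 1| ≤ e^{2ξ|E|}·|X − 1|`** for `e = exp iξE` (`ξ ≥ 0`) — the plaquette variables `∂𝐔 → R(e)∂𝐔` of (3.29).
[cite: Balaban1987RG1, (3.29) p.276] -/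
theorem norm_conj_expI_sub_one_le {ξ : ℝ} (hξ : 0 ≤ ξ) (E X : 𝔸) :
    ‖(expI ξ E : 𝔸) * X * ↑(expI ξ E)⁻¹ - 1‖ ≤ Real.exp (2 * (ξ * ‖E‖)) * ‖X - 1‖ := by
  have h : (expI ξ E : 𝔸) * X * ↑(expI ξ E)⁻¹ - 1 = (expI ξ E : 𝔸) * (X - 1) * ↑(expI ξ E)⁻¹ := by
    rw [mul_sub, sub_mul, mul_one, Units.mul_inv]
  rw [h]
  exact norm_conj_expI_le hξ E (X - 1)

/-! ## §3. The new factorisation of `𝐔^v` for `v = w·exp(iξE)` -/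

/-- **The bond identity.**  For `𝐔(b) = e^{iξA′(b)}U(b)` and `v = w·e`, `e(x) = exp iξE(x)`:
`𝐔^v(b) = exp iξ(R(w(b₋))A″(b)) · U^w(b)`,  `A″(b) = newPot ξ E(b₋) (newPot ξ A′(b) (−R(U(b))E(b₊)))`
— the transported configuration factorises again as «(exp iξA‴)·(G-valued)», provided the two BCH steps are in range
(`ξ(|A′(b)| + |R(U(b))E(b₊)|) ≤ 1/4`, `ξ(|E(b₋)| + |newPot …|) ≤ 1/4`). [cite: Balaban1987RG1, (3.29) p.276] -/
theorem gaugeU_factor_near {P : Params} {i : ℕ} {ξ : ℝ} (hξ : 0 < ξ) (w : Site P i → 𝔸ˣ) (E : Site P i → 𝔸)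
    {Uc U : PBond P i → 𝔸ˣ} {A' : PBond P i → 𝔸} (b : PBond P i) (hf : Uc b = expI ξ (A' b) * U b)
    (h1 : ξ * (‖A' b‖ + ‖(U b : 𝔸) * (-E b.tgt) * ↑(U b)⁻¹‖) ≤ 1 / 4)
    (h2 : ξ * (‖E b.src‖ + ‖newPot ξ (A' b) ((U b : 𝔸) * (-E b.tgt) * ↑(U b)⁻¹)‖) ≤ 1 / 4) :
    gaugeU (w * fun x => expI ξ (E x)) Uc b =
      expI ξ ((w b.src : 𝔸) * newPot ξ (E b.src) (newPot ξ (A' b) ((U b : 𝔸) * (-E b.tgt) * ↑(U b)⁻¹)) * ↑(w b.src)⁻¹) *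
        gaugeU w U b := by
  -- unfold the action and split `(w₊e₊)⁻¹ = e₊⁻¹w₊⁻¹`, `e₊⁻¹ = exp iξ(−E(b₊))`
  simp only [gaugeU, Pi.mul_apply, mul_inv_rev, hf, inv_expI]
  -- move `exp iξ(−E(b₊))` through `U(b)`, then compose the three exponentials, then conjugate by `w₋`
  calc w b.src * expI ξ (E b.src) * (expI ξ (A' b) * U b) * (expI ξ (-E b.tgt) * (w b.tgt)⁻¹)
      = w b.src * (expI ξ (E b.src) * (expI ξ (A' b) * (U b * expI ξ (-E b.tgt)))) * (w b.tgt)⁻¹ := by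
        simp only [mul_assoc]
    _ = w b.src * (expI ξ (E b.src) * (expI ξ (A' b) * expI ξ ((U b : 𝔸) * (-E b.tgt) * ↑(U b)⁻¹))) * U b *
          (w b.tgt)⁻¹ := by
        rw [mul_expI_eq (U b) ξ (-E b.tgt)]; simp only [mul_assoc]
    _ = w b.src * expI ξ (newPot ξ (E b.src) (newPot ξ (A' b) ((U b : 𝔸) * (-E b.tgt) * ↑(U b)⁻¹))) * U b *
          (w b.tgt)⁻¹ := by
        rw [expI_mul_expI hξ h1, expI_mul_expI hξ h2]
    _ = expI ξ ((w b.src : 𝔸) * newPot ξ (E b.src) (newPot ξ (A' b) ((U b : 𝔸) * (-E b.tgt) * ↑(U b)⁻¹)) *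
            ↑(w b.src)⁻¹) * w b.src * U b * (w b.tgt)⁻¹ := by
        rw [mul_expI_eq (w b.src)]
    _ = _ := by simp only [mul_assoc]

/-! ## §4. The size of the new potential -/

/-- **The size of the inner composition `N = newPot ξ A′(b) (−R(U(b))E(b₊))`.**  If `|E(b₊)| ≤ δ`, `|A′(b)| ≤ α₁`, `U(b) ∈ G`
(`‖·‖ ≤ 1` on `G`), `ξ > 0`, `ξ(α₁ + 2δ) ≤ 1/16`: the BCH step is in range, `|N| ≤ |A′(b)| + δ + 3ξ(α₁ + 2δ)²` and `|N| ≤ (19/16)(α₁ + 2δ) − δ`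
(`B12Membership313II.norm_newPot_le`). [cite: Balaban1987RG1, (3.29) p.276] -/
theorem norm_newPot2_le {G : Subgroup 𝔸ˣ} (hG1 : ∀ g ∈ G, ‖(g : 𝔸)‖ ≤ 1) {ξ α₁ δ : ℝ} (hξ : 0 < ξ) (hα₁ : 0 ≤ α₁)
    (hδ : 0 ≤ δ) (hs : ξ * (α₁ + 2 * δ) ≤ 1 / 16) {U : 𝔸ˣ} (hU : U ∈ G) {E₁ A : 𝔸} (hE₁ : ‖E₁‖ ≤ δ) (hA : ‖A‖ ≤ α₁) :
    ξ * (‖A‖ + ‖(U : 𝔸) * (-E₁) * ↑U⁻¹‖) ≤ 1 / 16 ∧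
      ‖newPot ξ A ((U : 𝔸) * (-E₁) * ↑U⁻¹)‖ ≤ ‖A‖ + δ + 3 * ξ * (α₁ + 2 * δ) ^ 2 ∧
        ‖newPot ξ A ((U : 𝔸) * (-E₁) * ↑U⁻¹)‖ + δ ≤ (19 / 16) * (α₁ + 2 * δ) := by
  set T := (U : 𝔸) * (-E₁) * ↑U⁻¹ with hT
  have hTn : ‖T‖ ≤ δ := by rw [hT, norm_conj_eq hG1 hU, norm_neg]; exact hE₁
  have h1 : ξ * (‖A‖ + ‖T‖) ≤ 1 / 16 := by nlinarith [norm_nonneg A, norm_nonneg T]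
  have hN := norm_newPot_le hξ (h1.trans (by norm_num))
  have hN' : ‖newPot ξ A T‖ ≤ ‖A‖ + δ + 3 * ξ * (α₁ + 2 * δ) ^ 2 := by
    have : 3 * ξ * (‖A‖ + ‖T‖) ^ 2 ≤ 3 * ξ * (α₁ + 2 * δ) ^ 2 := by
      apply mul_le_mul_of_nonneg_left _ (by positivity)
      exact pow_le_pow_left₀ (by positivity) (by linarith [norm_nonneg T]) 2
    linarith
  refine ⟨h1, hN', ?_⟩
  have : 3 * ξ * (α₁ + 2 * δ) ^ 2 ≤ (3 / 16) * (α₁ + 2 * δ) := by nlinarith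
  linarith

/-- **The size of `A″(b) = newPot ξ E(b₋) N`.**  If moreover `|E(b₋)| ≤ δ`: the second BCH step is in range and
`|A″(b)| ≤ |A′(b)| + 2δ + 8ξ(α₁ + 2δ)²` (`B12Membership313II.norm_newPot_le` again). [cite: Balaban1987RG1, (3.29) p.276] -/
theorem norm_newPot3_le {G : Subgroup 𝔸ˣ} (hG1 : ∀ g ∈ G, ‖(g : 𝔸)‖ ≤ 1) {ξ α₁ δ : ℝ} (hξ : 0 < ξ) (hα₁ : 0 ≤ α₁)
    (hδ : 0 ≤ δ) (hs : ξ * (α₁ + 2 * δ) ≤ 1 / 16) {U : 𝔸ˣ} (hU : U ∈ G) {E₀ E₁ A : 𝔸} (hE₀ : ‖E₀‖ ≤ δ) (hE₁ : ‖E₁‖ ≤ δ)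
    (hA : ‖A‖ ≤ α₁) :
    ξ * (‖E₀‖ + ‖newPot ξ A ((U : 𝔸) * (-E₁) * ↑U⁻¹)‖) ≤ 1 / 8 ∧
      ‖newPot ξ E₀ (newPot ξ A ((U : 𝔸) * (-E₁) * ↑U⁻¹))‖ ≤ ‖A‖ + 2 * δ + 8 * ξ * (α₁ + 2 * δ) ^ 2 := by
  obtain ⟨-, hN', hEN⟩ := norm_newPot2_le hG1 hξ hα₁ hδ hs hU hE₁ hA
  set N := newPot ξ A ((U : 𝔸) * (-E₁) * ↑U⁻¹) with hNdef
  have hEN' : ‖E₀‖ + ‖N‖ ≤ (19 / 16) * (α₁ + 2 * δ) := by linarith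
  have h2 : ξ * (‖E₀‖ + ‖N‖) ≤ 1 / 8 := by
    have h0 : 0 ≤ ‖E₀‖ + ‖N‖ := by positivity
    nlinarith
  have hM := norm_newPot_le hξ h2
  refine ⟨h2, ?_⟩
  have hsq : 3 * ξ * (‖E₀‖ + ‖N‖) ^ 2 ≤ 3 * ξ * ((19 / 16) * (α₁ + 2 * δ)) ^ 2 := by
    apply mul_le_mul_of_nonneg_left _ (by positivity)
    exact pow_le_pow_left₀ (by positivity) hEN' 2
  have h8 : 3 * ξ * (α₁ + 2 * δ) ^ 2 + 3 * ξ * ((19 / 16) * (α₁ + 2 * δ)) ^ 2 ≤ 8 * ξ * (α₁ + 2 * δ) ^ 2 := by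
    nlinarith [sq_nonneg (α₁ + 2 * δ), hξ.le]
  linarith

/-! ## §5. Loops: the conjugated plaquette `W = U_ν(x)⁻¹U_μ(x)U_ν(x+μ)U_μ(x+ν)⁻¹` -/

omit [NormedAlgebra ℂ 𝔸] [CompleteSpace 𝔸] in
/-- `|g⁻¹ − 1| ≤ |g − 1|` for `g ∈ G` (`‖·‖ ≤ 1` on `G`: `g⁻¹ − 1 = g⁻¹(1 − g)`). [folklore] -/
private theorem norm_inv_sub_one_le {G : Subgroup 𝔸ˣ} (hG1 : ∀ g ∈ G, ‖(g : 𝔸)‖ ≤ 1) {g : 𝔸ˣ} (hg : g ∈ G) :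
    ‖(↑g⁻¹ : 𝔸) - 1‖ ≤ ‖(g : 𝔸) - 1‖ := by
  have h : (↑g⁻¹ : 𝔸) - 1 = (↑g⁻¹ : 𝔸) * (1 - (g : 𝔸)) := by rw [mul_sub, mul_one, Units.inv_mul]
  rw [h]
  calc ‖(↑g⁻¹ : 𝔸) * (1 - (g : 𝔸))‖ ≤ ‖(↑g⁻¹ : 𝔸)‖ * ‖1 - (g : 𝔸)‖ := norm_mul_le _ _
    _ ≤ 1 * ‖1 - (g : 𝔸)‖ := mul_le_mul_of_nonneg_right (hG1 _ (G.inv_mem hg)) (norm_nonneg _)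
    _ = ‖(g : 𝔸) - 1‖ := by rw [one_mul, norm_sub_rev]

omit [NormedAlgebra ℂ 𝔸] [CompleteSpace 𝔸] in
/-- **The loop is a conjugate of the plaquette** (`μ < ν`): with `a = U_μ(x)`, `c = U_ν(x+μ)`, `d = U_μ(x+ν)`, `b = U_ν(x)`, the plaquette
variable is `∂U(p) = acd⁻¹b⁻¹` (`B12RegularSpaces111.plaq_eq`) and the loop `W = b⁻¹acd⁻¹ = b⁻¹·∂U(p)·b`, so `|W − 1| = |∂U(p) − 1|` for `b ∈ G`.
[cite: Balaban1987RG1, (1.11) p.262] -/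
theorem norm_loop_sub_one_eq {G : Subgroup 𝔸ˣ} (hG1 : ∀ g ∈ G, ‖(g : 𝔸)‖ ≤ 1) {a b c d : 𝔸ˣ} (hb : b ∈ G) :
    ‖((b⁻¹ * a * c * d⁻¹ : 𝔸ˣ) : 𝔸) - 1‖ = ‖((a * c * d⁻¹ * b⁻¹ : 𝔸ˣ) : 𝔸) - 1‖ := by
  have h : b⁻¹ * a * c * d⁻¹ = b⁻¹ * (a * c * d⁻¹ * b⁻¹) * b⁻¹⁻¹ := by rw [inv_inv]; group
  rw [h, Units.val_mul, Units.val_mul, norm_conj_sub_one_eq hG1 (G.inv_mem hb)]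

omit [NormedAlgebra ℂ 𝔸] [CompleteSpace 𝔸] in
/-- **The loop for `μ > ν`**: then the positively oriented plaquette is `∂U(p′) = bdc⁻¹a⁻¹` and `W = b⁻¹·∂U(p′)⁻¹·b`, so
`|W − 1| ≤ |∂U(p′) − 1|` (all four bond variables in `G`). [cite: Balaban1987RG1, (1.11) p.262] -/
theorem norm_loop_sub_one_le_of_gt {G : Subgroup 𝔸ˣ} (hG1 : ∀ g ∈ G, ‖(g : 𝔸)‖ ≤ 1) {a b c d : 𝔸ˣ} (ha : a ∈ G) (hb : b ∈ G)
    (hc : c ∈ G) (hd : d ∈ G) :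
    ‖((b⁻¹ * a * c * d⁻¹ : 𝔸ˣ) : 𝔸) - 1‖ ≤ ‖((b * d * c⁻¹ * a⁻¹ : 𝔸ˣ) : 𝔸) - 1‖ := by
  have h : b⁻¹ * a * c * d⁻¹ = b⁻¹ * (b * d * c⁻¹ * a⁻¹)⁻¹ * b⁻¹⁻¹ := by rw [inv_inv]; group
  have hp : b * d * c⁻¹ * a⁻¹ ∈ G := G.mul_mem (G.mul_mem (G.mul_mem hb hd) (G.inv_mem hc)) (G.inv_mem ha)
  rw [h, Units.val_mul, Units.val_mul, norm_conj_sub_one_eq hG1 (G.inv_mem hb)]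
  exact norm_inv_sub_one_le hG1 hp

omit [NormedAlgebra ℂ 𝔸] [CompleteSpace 𝔸] in
/-- The degenerate loop `μ = ν` (`a = b`, `c = d`): `W = 1` — no plaquette. [cite: Balaban1987RG1, (1.11) p.262] -/
theorem loop_eq_one_of_eq (a c : 𝔸ˣ) : a⁻¹ * a * c * c⁻¹ = 1 := by group

/-- Smallness for one BCH step, public form: `ξ(|a| + |b|) ≤ 1/4 ⟹ |e^{iξa}e^{iξb} − 1| < 1` (`ξ ≥ 0`; the hypothesis `hw` of
`B12Membership313II.norm_covD_newPot_le`). [cite: Balaban1987RG1, (1.13) p.262] -/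
theorem norm_expI_prod_sub_one_lt_one {ξ : ℝ} (hξ : 0 ≤ ξ) {a b : 𝔸} (h : ξ * (‖a‖ + ‖b‖) ≤ 1 / 4) :
    ‖exp ((I * ξ) • a) * exp ((I * ξ) • b) - 1‖ < 1 :=
  norm_expProd_sub_one_lt_one hξ h

/-! ## §6. The covariant derivative of the transported field `−R(U(b))E(b₊)` -/

omit [NormedAlgebra ℂ 𝔸] [CompleteSpace 𝔸] in
/-- `|WZW⁻¹ − Z| ≤ 2|W − 1||Z|` for `W ∈ G` (`‖·‖ ≤ 1` on `G`; `WZW⁻¹ − Z = (W − 1)ZW⁻¹ + Z(W⁻¹ − 1)`). [folklore] -/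
private theorem norm_conj_sub_self_le {G : Subgroup 𝔸ˣ} (hG1 : ∀ g ∈ G, ‖(g : 𝔸)‖ ≤ 1) {W : 𝔸ˣ} (hW : W ∈ G) (Z : 𝔸) :
    ‖(W : 𝔸) * Z * ↑W⁻¹ - Z‖ ≤ 2 * ‖(W : 𝔸) - 1‖ * ‖Z‖ := by
  have h : (W : 𝔸) * Z * ↑W⁻¹ - Z = ((W : 𝔸) - 1) * Z * ↑W⁻¹ + Z * ((↑W⁻¹ : 𝔸) - 1) := by
    noncomm_ring
  rw [h]
  have h1 : ‖((W : 𝔸) - 1) * Z * ↑W⁻¹‖ ≤ ‖(W : 𝔸) - 1‖ * ‖Z‖ :=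
    calc ‖((W : 𝔸) - 1) * Z * ↑W⁻¹‖ ≤ ‖((W : 𝔸) - 1) * Z‖ * ‖(↑W⁻¹ : 𝔸)‖ := norm_mul_le _ _
      _ ≤ ‖(W : 𝔸) - 1‖ * ‖Z‖ * 1 := by gcongr; exacts [norm_mul_le _ _, hG1 _ (G.inv_mem hW)]
      _ = ‖(W : 𝔸) - 1‖ * ‖Z‖ := mul_one _
  have h2 : ‖Z * ((↑W⁻¹ : 𝔸) - 1)‖ ≤ ‖Z‖ * ‖(W : 𝔸) - 1‖ :=
    (norm_mul_le _ _).trans (mul_le_mul_of_nonneg_left (norm_inv_sub_one_le hG1 hW) (norm_nonneg _))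
  calc _ ≤ ‖((W : 𝔸) - 1) * Z * ↑W⁻¹‖ + ‖Z * ((↑W⁻¹ : 𝔸) - 1)‖ := norm_add_le _ _
    _ ≤ ‖(W : 𝔸) - 1‖ * ‖Z‖ + ‖Z‖ * ‖(W : 𝔸) - 1‖ := add_le_add h1 h2
    _ = 2 * ‖(W : 𝔸) - 1‖ * ‖Z‖ := by ring

omit [CompleteSpace 𝔸] in
/-- `‖ξ⁻¹•Y‖ = ξ⁻¹‖Y‖` (`ξ > 0`). [folklore] -/
private theorem norm_inv_smul' {ξ : ℝ} (hξ : 0 < ξ) (Y : 𝔸) : ‖(ξ : ℂ)⁻¹ • Y‖ = ξ⁻¹ * ‖Y‖ := by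
  rw [norm_smul, norm_inv, Complex.norm_real, Real.norm_eq_abs, abs_of_pos hξ]

omit [CompleteSpace 𝔸] in
/-- **The covariant derivative of the transported field.**  Along the bond `a = U_μ(x)` compare the transported values
`T(x) = −R(b)E₁` (`b = U_ν(x)`, `E₁ = E(x+ν)`) and `T(x+μ) = −R(c)E₂` (`c = U_ν(x+μ)`, `E₂ = E(x+μ+ν) = E((x+ν)+μ)`): with `d = U_μ(x+ν)` and
the loop `W = b⁻¹acd⁻¹`, all in `G`,
`‖ξ⁻¹(R(a)T(x+μ) − T(x))‖ ≤ 2ξ⁻¹|W − 1||E₂| + ‖ξ⁻¹(R(d)E₂ − E₁)‖`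
— the covariant derivative of `T` is that of `E` at the shifted site up to a plaquette of the `G`-valued factor.
[cite: Balaban1987RG1, (1.13) p.262] -/
theorem norm_covD_transport_le {G : Subgroup 𝔸ˣ} (hG1 : ∀ g ∈ G, ‖(g : 𝔸)‖ ≤ 1) {ξ : ℝ} (hξ : 0 < ξ) {a b c d : 𝔸ˣ}
    (ha : a ∈ G) (hb : b ∈ G) (hc : c ∈ G) (hd : d ∈ G) (E₁ E₂ : 𝔸) :
    ‖(ξ : ℂ)⁻¹ • ((a : 𝔸) * ((c : 𝔸) * (-E₂) * ↑c⁻¹) * ↑a⁻¹ - (b : 𝔸) * (-E₁) * ↑b⁻¹)‖ ≤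
      2 * ξ⁻¹ * ‖((b⁻¹ * a * c * d⁻¹ : 𝔸ˣ) : 𝔸) - 1‖ * ‖E₂‖ + ‖(ξ : ℂ)⁻¹ • ((d : 𝔸) * E₂ * ↑d⁻¹ - E₁)‖ := by
  set W : 𝔸ˣ := b⁻¹ * a * c * d⁻¹ with hWdef
  set Z : 𝔸 := (d : 𝔸) * E₂ * ↑d⁻¹ with hZdef
  have hWG : W ∈ G := G.mul_mem (G.mul_mem (G.mul_mem (G.inv_mem hb) ha) hc) (G.inv_mem hd)
  -- `a c E₂ c⁻¹ a⁻¹ = b (W Z W⁻¹) b⁻¹`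
  have key : (a : 𝔸) * ((c : 𝔸) * (-E₂) * ↑c⁻¹) * ↑a⁻¹ - (b : 𝔸) * (-E₁) * ↑b⁻¹ =
      -((b : 𝔸) * ((W : 𝔸) * Z * ↑W⁻¹ - E₁) * ↑b⁻¹) := by
    simp only [hWdef, hZdef, Units.val_mul, mul_inv_rev, inv_inv, mul_neg, neg_mul, mul_sub, sub_mul, neg_sub]
    simp only [mul_assoc, Units.mul_inv_cancel_left, Units.inv_mul_cancel_left, Units.mul_inv, mul_one]
    abel
  rw [key, smul_neg, norm_neg, ← units_conj_smul, norm_conj_eq hG1 hb, smul_sub]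
  have hsplit : (ξ : ℂ)⁻¹ • ((W : 𝔸) * Z * ↑W⁻¹) - (ξ : ℂ)⁻¹ • E₁ =
      (ξ : ℂ)⁻¹ • ((W : 𝔸) * Z * ↑W⁻¹ - Z) + (ξ : ℂ)⁻¹ • (Z - E₁) := by
    rw [smul_sub, smul_sub]; abel
  rw [hsplit]
  refine (norm_add_le _ _).trans (add_le_add ?_ le_rfl)
  rw [norm_inv_smul' hξ]
  have hZ : ‖Z‖ = ‖E₂‖ := norm_conj_eq hG1 hd E₂
  calc ξ⁻¹ * ‖(W : 𝔸) * Z * ↑W⁻¹ - Z‖ ≤ ξ⁻¹ * (2 * ‖(W : 𝔸) - 1‖ * ‖Z‖) :=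
        mul_le_mul_of_nonneg_left (norm_conj_sub_self_le hG1 hWG Z) (by positivity)
    _ = 2 * ξ⁻¹ * ‖(W : 𝔸) - 1‖ * ‖E₂‖ := by rw [hZ]; ring

/-! ## §7. `∇^ξ_U` versus `∇^ξ_𝐔`: the covariant derivative of `E` in the `G`-valued factor from the one in `𝐔 = (exp iξA′)U` -/

/-- Real arithmetic: for `0 ≤ t ≤ 1/4`, `e^{t}(e^{t} − 1) ≤ 2t`. [folklore] -/
private theorem exp_mul_exp_sub_one_le {t : ℝ} (ht0 : 0 ≤ t) (ht : t ≤ 1 / 4) :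
    Real.exp t * (Real.exp t - 1) ≤ 2 * t := by
  have habs : |t| ≤ 1 := by rw [abs_of_nonneg ht0]; linarith
  have h1 := Real.abs_exp_sub_one_sub_id_le habs
  have h2 : Real.exp t - 1 ≤ t + t ^ 2 := by linarith [le_abs_self (Real.exp t - 1 - t)]
  have h3 : Real.exp t ≤ 1 + t + t ^ 2 := by linarith
  have h4 : 0 ≤ Real.exp t - 1 := by linarith [Real.add_one_le_exp t]
  have ht2 : t ^ 2 ≤ t * (1 / 4) := by nlinarith
  have ht3 : t ^ 3 ≤ t * (1 / 16) := by nlinarith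
  have ht4 : t ^ 4 ≤ t * (1 / 64) := by nlinarith
  calc Real.exp t * (Real.exp t - 1) ≤ (1 + t + t ^ 2) * (t + t ^ 2) := by gcongr
    _ = t + 2 * t ^ 2 + 2 * t ^ 3 + t ^ 4 := by ring
    _ ≤ 2 * t := by linarith

/-- **`∇^ξ_U` from `∇^ξ_𝐔`.**  For the full bond variable `𝐔(b) = e^{iξA′(b)}U(b)` (`B12RegularSpaces111.Factors`), `|A′(b)| ≤ α₁`, `ξ > 0`,
`ξα₁ ≤ 1/8`, and the values `E₀ = E(b₋)`, `E₁ = E(b₊)` with `|E₀| ≤ δ`: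
`‖ξ⁻¹(R(U(b))E₁ − E₀)‖ ≤ (1 + 4ξα₁)·‖ξ⁻¹(R(𝐔(b))E₁ − E₀)‖ + 4α₁δ`  (`B12Membership313II.norm_sub_le_of_expUnit_conj`: conjugation by
`e^{iξA′(b)}` costs `e^{2ξ|A′|}(e^{2ξ|A′|} − 1) ≤ 4ξα₁`). [cite: Balaban1987RG1, (1.13) p.262] -/
theorem norm_nabla_factor_le {ξ α₁ δ : ℝ} (hξ : 0 < ξ) (hs : ξ * α₁ ≤ 1 / 8) {Ucb U : 𝔸ˣ} {A E₀ E₁ : 𝔸}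
    (hf : Ucb = expI ξ A * U) (hA : ‖A‖ ≤ α₁) (hE₀ : ‖E₀‖ ≤ δ) :
    ‖(ξ : ℂ)⁻¹ • ((U : 𝔸) * E₁ * ↑U⁻¹ - E₀)‖ ≤
      (1 + 4 * ξ * α₁) * ‖(ξ : ℂ)⁻¹ • ((Ucb : 𝔸) * E₁ * ↑Ucb⁻¹ - E₀)‖ + 4 * α₁ * δ := by
  set At := (U : 𝔸) * E₁ * ↑U⁻¹ with hAt
  set Y := (I * ξ) • A with hY
  have hfull : (Ucb : 𝔸) * E₁ * ↑Ucb⁻¹ =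
      (Beta.BackgroundVertices.expUnit ℂ Y : 𝔸) * At * ↑(Beta.BackgroundVertices.expUnit ℂ Y)⁻¹ := by
    rw [hf, Units.val_mul, mul_inv_rev, Units.val_mul, hAt]
    simp only [expI, hY, mul_assoc]
  have hmain := norm_sub_le_of_expUnit_conj Y At E₀
  rw [← hfull] at hmain
  -- the dressing constant `κ = e^{2‖Y‖}(e^{2‖Y‖} − 1) ≤ 4ξα₁`
  have hYn : ‖Y‖ ≤ ξ * α₁ := by rw [hY, norm_I_mul_smul hξ.le]; exact mul_le_mul_of_nonneg_left hA hξ.le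
  have hκ : Real.exp (2 * ‖Y‖) * (Real.exp (2 * ‖Y‖) - 1) ≤ 4 * ξ * α₁ := by
    have := exp_mul_exp_sub_one_le (t := 2 * ‖Y‖) (by positivity) (by linarith)
    linarith
  have hκ0 : 0 ≤ Real.exp (2 * ‖Y‖) * (Real.exp (2 * ‖Y‖) - 1) :=
    mul_nonneg (Real.exp_pos _).le (by linarith [Real.add_one_le_exp (2 * ‖Y‖), norm_nonneg Y])
  -- divide by `ξ`
  set D := (Ucb : 𝔸) * E₁ * ↑Ucb⁻¹ - E₀ with hD
  have e1 : ‖At - E₀‖ = ξ * ‖(ξ : ℂ)⁻¹ • (At - E₀)‖ := norm_eq_mul_norm_inv_smul hξ _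
  have e2 : ‖D‖ = ξ * ‖(ξ : ℂ)⁻¹ • D‖ := norm_eq_mul_norm_inv_smul hξ _
  rw [e1, e2] at hmain
  set n := ‖(ξ : ℂ)⁻¹ • (At - E₀)‖
  set m := ‖(ξ : ℂ)⁻¹ • D‖
  have hm0 : 0 ≤ m := norm_nonneg _
  have hδ0 : 0 ≤ δ := (norm_nonneg _).trans hE₀
  -- `ξ n ≤ ξ m + κ(δ + ξ m)` ⟹ `n ≤ (1 + κ) m + κ δ/ξ ≤ (1 + 4ξα₁) m + 4α₁δ`
  have h3 : ξ * n ≤ ξ * m + 4 * ξ * α₁ * (δ + ξ * m) := by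
    calc ξ * n ≤ ξ * m + Real.exp (2 * ‖Y‖) * (Real.exp (2 * ‖Y‖) - 1) * (‖E₀‖ + ξ * m) := hmain
      _ ≤ ξ * m + 4 * ξ * α₁ * (δ + ξ * m) := by
          gcongr ξ * m + ?_
          calc Real.exp (2 * ‖Y‖) * (Real.exp (2 * ‖Y‖) - 1) * (‖E₀‖ + ξ * m)
              ≤ Real.exp (2 * ‖Y‖) * (Real.exp (2 * ‖Y‖) - 1) * (δ + ξ * m) := by gcongr
            _ ≤ 4 * ξ * α₁ * (δ + ξ * m) := mul_le_mul_of_nonneg_right hκ (by positivity)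
  have h4 : n ≤ m + 4 * α₁ * (δ + ξ * m) :=
    le_of_mul_le_mul_left (show ξ * n ≤ ξ * (m + 4 * α₁ * (δ + ξ * m)) by nlinarith) hξ
  have e : m + 4 * α₁ * (δ + ξ * m) = (1 + 4 * ξ * α₁) * m + 4 * α₁ * δ := by ring
  linarith

end

end Literature.MathematicalPhysics.QuantumFieldTheory.Balaban1983to89.B12Spaces329NearBond
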